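import Summits.CriticalPhenomena.PercolationContinuityZ3.Theorems.Transplant.FKConnectivityAllQForestAdjacentGuard
import Summits.CriticalPhenomena.PercolationContinuityZ3.Theorems.Transplant.FKConnectivityAllQForestAdjacentSlice
import HarnessLib

/-!
# The square-free adjacent forest Rayleigh node reduces to its SPLIT fibres (`e, f` both in the fibre's free part, `o, v, y` distinct):
# every other fibre is an identity or trivial

Support file (`--supports stmt-CriticalPhenomena-4575`), FK sub-lane `prim-bschramm-fk-1` (gen 17) of the post-continuity programme;
builds on p205010 (kernel theorem, internal audit signed; external expert review pending).  No definitions, no named facts, no sorries;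
standard axioms.

`AdjForestRayleighNoSqOn V` (p310496) asks, for EVERY fibre `(M', u₀)` and all `o, v ≠ y`, that
`#(Fo ∩ {e, f ∈ ω}, Fo) ≤ #(Fo ∩ {e ∈ ω}, Fo ∩ {f ∈ ω})` with `e = ov`, `f = oy`.  **`adjForestRayleighNoSqOn_of_split`**: it suffices to
prove this on the fibres `(M ∪ {e,f}, u₀)` with `e, f ∉ M ∪ u₀` and `o, v, y` pairwise distinct — the fibres reached by gen 17's forest
slice (`adjForestNoSq_fibre_of_gradedNoSqOn`, `…ForestAdjacentSliceNoSq.lean`).  The other fibres, case by case (all in the kernel here):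
* `o = v` or `o = y`: a pinned pair is a loop, no forest contains it, the left side is `0` (`fibreCount_eq_zero_of_forall`);
* `e ∉ M' ∪ u₀` or `f ∉ M' ∪ u₀`: no configuration of the fibre contains it, left side `0`;
* `e ∈ u₀, f ∈ u₀` / `e ∈ M', f ∈ u₀`: both sides count the same pairs (`fibreCount_eq_of_bij` with the identity);
* `e ∈ u₀, f ∈ M'`: the involution `ω ↦ ω ∆ M'` of the fibre exchanges the two sides (`fibreCount_eq_of_bij`), so they are EQUAL;
* `e, f ∈ M'`: the split case, `M' = (M' ∖ {e,f}) ∪ {e,f}` (`insert_two_sdiff_pair`).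
Successor use: with a transport of fibre counts along `Fin n ↪ Fin (n+1)` (spare vertex) this closes
`TwoClusterRayleighGradedNoSqPos → AdjForestRayleighNoSqPos`.
[cite: SempleWelsh2008, Conj. 1.1 (p. 2)] [cite: CibulkaHladkyLaCroixWagner2008, Thm. 1 (p. 2)] [cite: Linusson2011, Prop. 2.6]
-/

noncomputable section

namespace Summit.CriticalPhenomena.PercolationContinuityZ3.Theorems

namespace FK

open MeasureTheory Set Literature.Probability.LatticeModels Literature.Probability.Percolation
open scoped Classical symmDiff

variable {V : Type*} [Fintype V]

omit [Fintype V] in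
/-- `(ω ∆ M) ∖ M = ω ∖ M`. [folklore] -/
theorem symmDiff_sdiff_self_right (ω M : BondConfig V) : (ω ∆ M) \ M = ω \ M := by
  ext x
  simp only [mem_sdiff, Set.mem_symmDiff]
  tauto

omit [Fintype V] in
/-- On the fibre `(M, u₀)`, the common part `u₀` lies inside every configuration. [folklore] -/
theorem subset_of_fibre {ω M u₀ : BondConfig V} (hω : ω \ M = u₀) : u₀ ⊆ ω := by
  rw [← hω]; exact sdiff_subset

omit [Fintype V] in
/-- No forest contains a loop. [cite: Grimmett2006, §1.5 (p. 13)] -/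
theorem not_mem_of_isForestCfg_of_isDiag {ω : BondConfig V} (hF : IsForestCfg ω) {g : Sym2 V} (hg : g.IsDiag) : g ∉ ω :=
  fun h => hF.1 g h hg

/-- **Reduction of the square-free node to split fibres with distinct marked vertices.** [cite: SempleWelsh2008, Conj. 1.1 (p. 2)]
[cite: CibulkaHladkyLaCroixWagner2008, Thm. 1 (p. 2)] [cite: Linusson2011, Prop. 2.6] -/
theorem adjForestRayleighNoSqOn_of_split
    (h : ∀ (M u₀ : BondConfig V), Disjoint u₀ M → ∀ (o v y : V), o ≠ v → o ≠ y → v ≠ y →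
      s(o, v) ∉ M → s(o, y) ∉ M → s(o, v) ∉ u₀ → s(o, y) ∉ u₀ →
      fibreCount (insert s(o, y) (insert s(o, v) M)) u₀ (forestEv V ∩ {ω | s(o, v) ∈ ω ∧ s(o, y) ∈ ω}) (forestEv V) ≤
        fibreCount (insert s(o, y) (insert s(o, v) M)) u₀ (forestEv V ∩ {ω | s(o, v) ∈ ω}) (forestEv V ∩ {ω | s(o, y) ∈ ω})) :
    AdjForestRayleighNoSqOn V := by
  intro M' u₀ hd o v y hvy
  -- loops: the left side vanishes
  by_cases hov : o = v
  · subst hov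
    rw [fibreCount_eq_zero_of_forall _ _ _ _ fun ω _ hA _ =>
      not_mem_of_isForestCfg_of_isDiag hA.1 (Sym2.mk_isDiag_iff.2 rfl) hA.2.1]
    exact Nat.zero_le _
  by_cases hoy : o = y
  · subst hoy
    rw [fibreCount_eq_zero_of_forall _ _ _ _ fun ω _ hA _ =>
      not_mem_of_isForestCfg_of_isDiag hA.1 (Sym2.mk_isDiag_iff.2 rfl) hA.2.2]
    exact Nat.zero_le _
  -- a pinned pair outside the fibre: the left side vanishes
  by_cases he : s(o, v) ∉ M' ∧ s(o, v) ∉ u₀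
  · rw [fibreCount_eq_zero_of_forall _ _ _ _ fun ω hω hA _ =>
      (mem_union_of_fibre hω hA.2.1).elim he.1 he.2]
    exact Nat.zero_le _
  by_cases hf : s(o, y) ∉ M' ∧ s(o, y) ∉ u₀
  · rw [fibreCount_eq_zero_of_forall _ _ _ _ fun ω hω hA _ =>
      (mem_union_of_fibre hω hA.2.2).elim hf.1 hf.2]
    exact Nat.zero_le _
  rw [not_and_or, not_not, not_not] at he hf
  have hdis : ∀ {g : Sym2 V}, g ∈ u₀ → g ∉ M' := fun hg hgM => Set.disjoint_left.1 hd hg hgM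
  rcases he with heM | heu
  · rcases hf with hfM | hfu
    · -- the split case
      have hsplit : insert s(o, y) (insert s(o, v) (M' \ {s(o, v), s(o, y)})) = M' := insert_two_sdiff_pair heM hfM
      have heu : s(o, v) ∉ u₀ := fun h' => hdis h' heM
      have hfu : s(o, y) ∉ u₀ := fun h' => hdis h' hfM
      have key := h (M' \ {s(o, v), s(o, y)}) u₀ (hd.mono_right sdiff_subset) o v y hov hoy hvy
        (fun h' => h'.2 (Or.inl rfl)) (fun h' => h'.2 (Or.inr rfl)) heu hfu
      rw [hsplit] at key
      exact key
    · -- `e ∈ M'`, `f ∈ u₀`: both sides count the same pairs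
      refine le_of_eq (fibreCount_eq_of_bij id id (fun ω hω hA hB => ?_) (fun ω hω hA hB => ?_))
      · have hfω : s(o, y) ∈ ω := subset_of_fibre hω hfu
        exact ⟨hω, ⟨hA.1, hA.2.1⟩, ⟨hB, Set.mem_symmDiff.2 (Or.inl ⟨hfω, hdis hfu⟩)⟩, rfl⟩
      · have hfω : s(o, y) ∈ ω := subset_of_fibre hω hfu
        exact ⟨hω, ⟨hA.1, hA.2, hfω⟩, hB.1, rfl⟩
  · have heM : s(o, v) ∉ M' := hdis heu
    rcases hf with hfM | hfu
    · -- `e ∈ u₀`, `f ∈ M'`: the involution `ω ↦ ω ∆ M'` exchanges the two sides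
      refine le_of_eq (fibreCount_eq_of_bij (fun ω => ω ∆ M') (fun ω => ω ∆ M') (fun ω hω hA hB => ?_) (fun ω hω hA hB => ?_))
      · have heω : s(o, v) ∈ ω := subset_of_fibre hω heu
        refine ⟨by rw [symmDiff_sdiff_self_right, hω], ⟨hB, Set.mem_symmDiff.2 (Or.inl ⟨heω, heM⟩)⟩, ?_, symmDiff_symmDiff_cancel_right _ _⟩
        show ω ∆ M' ∆ M' ∈ forestEv V ∩ {ω | s(o, y) ∈ ω}
        rw [symmDiff_symmDiff_cancel_right]
        exact ⟨hA.1, hA.2.2⟩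
      · have heω : s(o, v) ∈ ω := subset_of_fibre hω heu
        refine ⟨by rw [symmDiff_sdiff_self_right, hω], ⟨hB.1, Set.mem_symmDiff.2 (Or.inl ⟨heω, heM⟩), hB.2⟩, ?_,
          symmDiff_symmDiff_cancel_right _ _⟩
        show ω ∆ M' ∆ M' ∈ forestEv V
        rw [symmDiff_symmDiff_cancel_right]
        exact hA.1
    · -- `e, f ∈ u₀`: both sides count the same pairs
      refine le_of_eq (fibreCount_eq_of_bij id id (fun ω hω hA hB => ?_) (fun ω hω hA hB => ?_))
      · have hfω : s(o, y) ∈ ω := subset_of_fibre hω hfu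
        exact ⟨hω, ⟨hA.1, hA.2.1⟩, ⟨hB, Set.mem_symmDiff.2 (Or.inl ⟨hfω, hdis hfu⟩)⟩, rfl⟩
      · have hfω : s(o, y) ∈ ω := subset_of_fibre hω hfu
        exact ⟨hω, ⟨hA.1, hA.2, hfω⟩, hB.1, rfl⟩

end FK

end Summit.CriticalPhenomena.PercolationContinuityZ3.Theorems

end
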